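import Mathlib
import HarnessLib
import Summits.NavierStokesRegularity.NavierStokesRegularity.Theorems.TaylorModelRungThreeCertificateReadoutVStepWin
import Summits.NavierStokesRegularity.NavierStokesRegularity.Theorems.TaylorModelRungThreeCertificateReadoutVInterpP
import Summits.NavierStokesRegularity.NavierStokesRegularity.Theorems.TaylorModelRungThreeVReadoutsWinDefs

/-!
# Crux K1b-DR (stmt-NavierStokesRegularity-23954), line `taylor-model` — v3 read-outs, K-SIDE part 5-W: the WINDOWED read-outs
# LAYOUT of a v3 certificate (ns-tm-g4 g6): the emitted CROSSING WINDOWS `WindowsV`, the windowed read-out input `roInWin`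
# (= part 5's `roIn` + the stage's window) and its checkpoint form `roInWin'`, the per-stage Boolean `checkReadoutStageWin'`,
# `checkReadoutsWin'`, and the records `toReadoutDataWin` / `toWinData` presented to `TaylorModelV.ReadoutsVW`

WHAT THE GENERATOR EMITS IN ADDITION (nothing else of the v5 layout changes): one array
`windowsV : WindowsV := #[⟨u0lo, u0hi, u1lo, u1hi⟩, …]` indexed by stage `j = 0 … N₀`, four dyadics per stage, offsets from
`Tn (S j − 1)` inside the last sub-step: `[u1lo, u1hi]` brackets the crossing times of ALL polytope trajectories (section before at
`Tn (S−1) + u1lo`, after at `Tn (S−1) + u1hi`), `[u0lo, u0hi] ⊆ [u1lo, u1hi]` brackets the crossing time of the CENTRE trajectory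
(any width the emitter can certify; `10⁻¹⁵` is fine).  The read-out Boolean of the assembly becomes
`checkReadoutsWin' kitOf wT A windowsV` (in place of `checkReadouts' kitOf wT A`); the closers are `…CertificateCloserVWin`.

* `StageWin`, `WindowsV`, `winAt` (junk window `0,0,0,0` beyond the array — fails `winOK` only if `h < 0`, and then (W2)/(W3) fail);
* `roInWin` / `roInWin'` (+ `roInWin'_eq`), `roOutWin` / `roOutWin'` (+ `roOutWin'_eq`), `checkReadoutStageWin'` (+ `_eq`),
  `checkReadoutsWin'`;
* `toReadoutDataWin G ΛT` — `ylo/yhi` = the FAT in-step boxes `Y0/Y1` of the step (for (R6)/(R7)), `Vlo/Vhi` = the WINDOWED kernel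
  box `VBw`; `toWinData` — `ulo/uhi` = the emitted windows (reals), `zlo/zhi` = the windowed boxes `Z0/Z1`.

Definitions + `rfl`/rewrite lemmas only.  HONEST FRAMING: kernel bookkeeping for the MODEL certificate №23954 (rung TL-M3);
nothing here is a statement about the Navier–Stokes equations, and nothing is asserted.
-/

-- the sub-problem namespace repeats the summit name by design (D-0017)
set_option linter.dupNamespace false

namespace Summit.NavierStokesRegularity.NavierStokesRegularity.Theorems.TaylorModelCert

open scoped BigOperators
open Literature.Analysis.FluidPDE.TaoCascade Literature.Analysis.FluidPDE.TaoCascade.TaylorChain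
open Summit.NavierStokesRegularity.NavierStokesRegularity.Theorems.TaylorModelV

/-- **The crossing windows of one stage** (emitted; offsets from `Tn (S−1)` inside the last sub-step): level 0 = the centre
trajectory's bracket `[u0lo, u0hi]`, level 1 = all polytope trajectories' bracket `[u1lo, u1hi]`. [folklore] -/
structure StageWin where
  (u0lo u0hi u1lo u1hi : Dyad)

/-- **The emitted crossing windows of a certificate**, indexed by stage. [folklore] -/
abbrev WindowsV := Array StageWin

/-- Window of stage `j` (junk zeros beyond the array). [folklore] -/
def winAt (WV : WindowsV) (j : ℕ) : StageWin := WV.getD j ⟨Dyad.ofInt 0, Dyad.ofInt 0, Dyad.ofInt 0, Dyad.ofInt 0⟩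

namespace CertTablesV

section Defs

variable (TV : CertTablesV) (kitOf : ℕ → CoreKit) (wT : ℕ → Array Dyad) (A : ReadoutAux QS2) (WV : WindowsV)

/-- **The windowed read-out input of stage `j`** (semantic form: part 5's `roIn` + the window). [folklore] -/
def roInWin (j : ℕ) : ROInWin :=
  { base := TV.roIn kitOf wT A j, u0lo := (winAt WV j).u0lo, u0hi := (winAt WV j).u0hi,
    u1lo := (winAt WV j).u1lo, u1hi := (winAt WV j).u1hi }

/-- **The windowed read-out input of stage `j`, CHECKPOINT FORM** (part 6's `roIn'`: nodes `S−1`, `S` read from the emitted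
checkpoints, one core step) — the form the kernel evaluates. [folklore] -/
def roInWin' (j : ℕ) : ROInWin :=
  { base := TV.roIn' kitOf wT A j, u0lo := (winAt WV j).u0lo, u0hi := (winAt WV j).u0hi,
    u1lo := (winAt WV j).u1lo, u1hi := (winAt WV j).u1hi }

/-- `roInWin'` is `roInWin` (by `roIn'_eq`). [folklore] -/
theorem roInWin'_eq (j : ℕ) : TV.roInWin' kitOf wT A WV j = TV.roInWin kitOf wT A WV j := by
  simp only [roInWin', roInWin, roIn'_eq]

/-- The windowed read-out step output of stage `j`. [folklore] -/
def roOutWin (j : ℕ) : ROOutWin := TV.base.readoutStepWin (TV.roInWin kitOf wT A WV j)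

/-- The windowed read-out step output of stage `j`, checkpoint form. [folklore] -/
def roOutWin' (j : ℕ) : ROOutWin := TV.base.readoutStepWin (TV.roInWin' kitOf wT A WV j)

/-- `roOutWin'` is `roOutWin`. [folklore] -/
theorem roOutWin'_eq (j : ℕ) : TV.roOutWin' kitOf wT A WV j = TV.roOutWin kitOf wT A WV j := by
  simp only [roOutWin', roOutWin, roInWin'_eq]

/-- **Per-stage windowed read-out check, checkpoint form** (the per-sub-step (R4) window test rides on the chunk replay, as in
part 6). [folklore] -/
def checkReadoutStageWin' (j : ℕ) : Bool := (TV.roOutWin' kitOf wT A WV j).ok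

/-- **All stages, checkpoint form**, plus the surrogate certification — THE READ-OUT BOOLEAN OF THE WINDOWED ASSEMBLY. [folklore] -/
def checkReadoutsWin' : Bool :=
  TV.base.checkReadoutAux A && allN (TV.base.N₀ + 1) fun j => TV.checkReadoutStageWin' kitOf wT A WV j

/-- `checkReadoutStageWin'` is the verdict of the semantic-form step. [folklore] -/
theorem checkReadoutStageWin'_eq (j : ℕ) : TV.checkReadoutStageWin' kitOf wT A WV j = (TV.roOutWin kitOf wT A WV j).ok := by
  simp only [checkReadoutStageWin', roOutWin'_eq]

/-! ### The records presented to `ReadoutsVW` -/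

/-- **The `ReadoutData` record of the windowed read-outs**: `ylo/yhi l j` = the FAT in-step boxes `Y0/Y1` of the last sub-step
((R6)/(R7)), `[Vlo, Vhi]` = the WINDOWED derivative kernel box `VBw` ((R10w)); `G`, `ΛT` passed through. [folklore] -/
noncomputable def toReadoutDataWin (G : ℕ → ℕ → ℕ → ℝ) (ΛT : ℕ → ℝ) : ReadoutData where
  ylo := fun l j => match l with
    | ⟨0, _⟩ => TV.base.vecF (IntervalD.loR (TV.roOutWin kitOf wT A WV j).Y0)
    | ⟨_ + 1, _⟩ => TV.base.vecF (IntervalD.loR (TV.roOutWin kitOf wT A WV j).Y1)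
  yhi := fun l j => match l with
    | ⟨0, _⟩ => TV.base.vecF (IntervalD.hiR (TV.roOutWin kitOf wT A WV j).Y0)
    | ⟨_ + 1, _⟩ => TV.base.vecF (IntervalD.hiR (TV.roOutWin kitOf wT A WV j).Y1)
  Vlo := fun j => TV.base.kerLo (TV.roOutWin kitOf wT A WV j).VB
  Vhi := fun j => TV.base.kerHi (TV.roOutWin kitOf wT A WV j).VB
  G := G
  ΛT := ΛT

/-- **The `WinData` record of the windowed read-outs**: the emitted windows (as reals) and the windowed in-step boxes
`Z0/Z1`. [folklore] -/
noncomputable def toWinData : WinData where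
  ulo := fun l j => match l with
    | ⟨0, _⟩ => (winAt WV j).u0lo.toReal
    | ⟨_ + 1, _⟩ => (winAt WV j).u1lo.toReal
  uhi := fun l j => match l with
    | ⟨0, _⟩ => (winAt WV j).u0hi.toReal
    | ⟨_ + 1, _⟩ => (winAt WV j).u1hi.toReal
  zlo := fun l j => match l with
    | ⟨0, _⟩ => TV.base.vecF (IntervalD.loR (TV.roOutWin kitOf wT A WV j).Z0)
    | ⟨_ + 1, _⟩ => TV.base.vecF (IntervalD.loR (TV.roOutWin kitOf wT A WV j).Z1)
  zhi := fun l j => match l with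
    | ⟨0, _⟩ => TV.base.vecF (IntervalD.hiR (TV.roOutWin kitOf wT A WV j).Z0)
    | ⟨_ + 1, _⟩ => TV.base.vecF (IntervalD.hiR (TV.roOutWin kitOf wT A WV j).Z1)

end Defs

/-! ### Field reductions (all definitional) -/

section Rfl

variable {TV : CertTablesV} {kitOf : ℕ → CoreKit} {wT : ℕ → Array Dyad} {A : ReadoutAux QS2} {WV : WindowsV}

/-- [folklore] -/ theorem roInWin_base (j : ℕ) : (TV.roInWin kitOf wT A WV j).base = TV.roIn kitOf wT A j := rfl
/-- [folklore] -/ theorem roInWin_u0lo (j : ℕ) : (TV.roInWin kitOf wT A WV j).u0lo = (winAt WV j).u0lo := rfl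
/-- [folklore] -/ theorem roInWin_u0hi (j : ℕ) : (TV.roInWin kitOf wT A WV j).u0hi = (winAt WV j).u0hi := rfl
/-- [folklore] -/ theorem roInWin_u1lo (j : ℕ) : (TV.roInWin kitOf wT A WV j).u1lo = (winAt WV j).u1lo := rfl
/-- [folklore] -/ theorem roInWin_u1hi (j : ℕ) : (TV.roInWin kitOf wT A WV j).u1hi = (winAt WV j).u1hi := rfl
/-- [folklore] -/
theorem roOutWin_ok (j : ℕ) : (TV.roOutWin kitOf wT A WV j).ok = (TV.base.readoutStepWin (TV.roInWin kitOf wT A WV j)).ok := rfl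
/-- [folklore] -/
theorem row_ylo0 (G : ℕ → ℕ → ℕ → ℝ) (ΛT : ℕ → ℝ) (j : ℕ) :
    (TV.toReadoutDataWin kitOf wT A WV G ΛT).ylo 0 j = TV.base.vecF (IntervalD.loR ((TV.roIn kitOf wT A j).Y0 TV.base)) := rfl
/-- [folklore] -/
theorem row_yhi0 (G : ℕ → ℕ → ℕ → ℝ) (ΛT : ℕ → ℝ) (j : ℕ) :
    (TV.toReadoutDataWin kitOf wT A WV G ΛT).yhi 0 j = TV.base.vecF (IntervalD.hiR ((TV.roIn kitOf wT A j).Y0 TV.base)) := rfl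
/-- [folklore] -/
theorem row_ylo1 (G : ℕ → ℕ → ℕ → ℝ) (ΛT : ℕ → ℝ) (j : ℕ) :
    (TV.toReadoutDataWin kitOf wT A WV G ΛT).ylo 1 j = TV.base.vecF (IntervalD.loR ((TV.roIn kitOf wT A j).Y1 TV.base)) := rfl
/-- [folklore] -/
theorem row_yhi1 (G : ℕ → ℕ → ℕ → ℝ) (ΛT : ℕ → ℝ) (j : ℕ) :
    (TV.toReadoutDataWin kitOf wT A WV G ΛT).yhi 1 j = TV.base.vecF (IntervalD.hiR ((TV.roIn kitOf wT A j).Y1 TV.base)) := rfl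
/-- [folklore] -/
theorem row_Vlo (G : ℕ → ℕ → ℕ → ℝ) (ΛT : ℕ → ℝ) (j : ℕ) :
    (TV.toReadoutDataWin kitOf wT A WV G ΛT).Vlo j = TV.base.kerLo ((TV.roInWin kitOf wT A WV j).VBw TV.base) := rfl
/-- [folklore] -/
theorem row_Vhi (G : ℕ → ℕ → ℕ → ℝ) (ΛT : ℕ → ℝ) (j : ℕ) :
    (TV.toReadoutDataWin kitOf wT A WV G ΛT).Vhi j = TV.base.kerHi ((TV.roInWin kitOf wT A WV j).VBw TV.base) := rfl
/-- [folklore] -/ theorem rw_ulo0 (j : ℕ) : (TV.toWinData kitOf wT A WV).ulo 0 j = (winAt WV j).u0lo.toReal := rfl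
/-- [folklore] -/ theorem rw_uhi0 (j : ℕ) : (TV.toWinData kitOf wT A WV).uhi 0 j = (winAt WV j).u0hi.toReal := rfl
/-- [folklore] -/ theorem rw_ulo1 (j : ℕ) : (TV.toWinData kitOf wT A WV).ulo 1 j = (winAt WV j).u1lo.toReal := rfl
/-- [folklore] -/ theorem rw_uhi1 (j : ℕ) : (TV.toWinData kitOf wT A WV).uhi 1 j = (winAt WV j).u1hi.toReal := rfl
/-- [folklore] -/
theorem rw_zlo0 (j : ℕ) : (TV.toWinData kitOf wT A WV).zlo 0 j = TV.base.vecF (IntervalD.loR ((TV.roInWin kitOf wT A WV j).Z0 TV.base)) := rfl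
/-- [folklore] -/
theorem rw_zhi0 (j : ℕ) : (TV.toWinData kitOf wT A WV).zhi 0 j = TV.base.vecF (IntervalD.hiR ((TV.roInWin kitOf wT A WV j).Z0 TV.base)) := rfl
/-- [folklore] -/
theorem rw_zlo1 (j : ℕ) : (TV.toWinData kitOf wT A WV).zlo 1 j = TV.base.vecF (IntervalD.loR ((TV.roInWin kitOf wT A WV j).Z1 TV.base)) := rfl
/-- [folklore] -/
theorem rw_zhi1 (j : ℕ) : (TV.toWinData kitOf wT A WV).zhi 1 j = TV.base.vecF (IntervalD.hiR ((TV.roInWin kitOf wT A WV j).Z1 TV.base)) := rfl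

end Rfl

end CertTablesV

end Summit.NavierStokesRegularity.NavierStokesRegularity.Theorems.TaylorModelCert
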